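import Literature.Geometry.Riemannian.CompositeChartEnergy
import Literature.Geometry.Riemannian.BoundaryFlatteningChart
import Literature.Geometry.Lorentzian.WeakSolutionChart
import Literature.Analysis.Calculus.MatrixFieldSmooth
import HarnessLib

/-!
# Test functions and integral identities in composite charts

Topic `Geometry/Riemannian`. Theorem file (no definitions, no named facts; everything proved).
Let `h` be a smooth Riemannian metric on a manifold `M` modelled on `ℝᵐ`, `φ = extChartAt (𝓡 m) x`,
and `Ψ` a `C^∞` local diffeomorphism of `ℝᵐ` with `Ψ.source ⊆ φ.target` (a composite chart
`Φ = Ψ ∘ φ`, e.g. a boundary-flattening chart of `BoundaryFlatteningChart.lean`). We provide the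
tools used to read the weak Neumann problem in the coordinates `w = Φ(p)`:

* `contDiff_indicator_comp_of_tsupport_subset` — a Euclidean test function `ζ` compactly
  supported in `Ψ.target` pulls back to a test function `1_{Ψ.source} · (ζ ∘ Ψ)` compactly
  supported in `Ψ.source`; `contMDiff_compositePullback` & co. — and further to a smooth
  compactly supported function `ζ_P` on `M` with `ζ_P ∘ Φ⁻¹ = ζ` on `Ψ.target`, vanishing off the
  composite piece over `tsupport ζ`;
* `contDiffOn_det_fderiv_symm`, `contDiffOn_abs_det_fderiv_symm_of_convex`,
  `contDiffOn_compositeDensity_of_convex` — the composite density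
  `ρ(w) = |det DΨ⁻¹(w)| √det(h_ij)(Ψ⁻¹ w)` is `C^∞` on convex parts of `Ψ.target`;
* `setIntegral_mul_compositePullback`, `setIntegral_mul_innerDual_compositePullback` — the
  identities `∫_D F ζ_P dμ_h = ∫_Q ρ (F ∘ Φ⁻¹) ζ dw` and
  `∫_D f h⁻¹(da, dζ_P) dμ_h = ∫_Q ρ (f ∘ Φ⁻¹) ⟪M ∇ã, ∇ζ⟫ dw` for a measurable set `D` whose
  part in the piece over `B ⊇ tsupport ζ` is the piece over `Q ⊆ B` (`M` the coefficient field of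
  `CompositeChartEnergy.lean`, `ã = a ∘ Φ⁻¹`).

(J. M. Lee, *Introduction to Smooth Manifolds* (2013), Lemma 2.26 / Prop. 2.25 (extension by
zero), Ch. 16 (change of variables); E. Hebey (1999), §2.2.)

## References

* J. M. Lee, *Introduction to Smooth Manifolds*, 2nd ed. (2013), Lemma 2.26, Prop. 16.6.
  [LeeSmoothManifolds2013]
* E. Hebey, *Nonlinear Analysis on Manifolds: Sobolev Spaces and Inequalities* (1999), §2.2.
-/

noncomputable section

open MeasureTheory Measure Set Filter Metric Module InnerProductSpace TopologicalSpace Function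
open scoped ENNReal NNReal Manifold ContDiff Topology RealInnerProductSpace

namespace Literature.Geometry.Riemannian

open Lorentzian
open Bundle PseudoRiemannianMetric Literature.Analysis.Calculus Literature.Geometry.Manifold

/-! ### Euclidean zero extension through a local diffeomorphism -/

section Euclidean

variable {H : Type*} [NormedAddCommGroup H] [NormedSpace ℝ H]

/-- **Zero extension of `ζ ∘ Ψ`.** For a `C^∞` function `ζ` with compact support inside
`Ψ.target` and `Ψ` of class `C^∞` on `Ψ.source`, the function `1_{Ψ.source} · (ζ ∘ Ψ)` is `C^∞` on
the whole space, has compact support inside `Ψ.source`, equals `ζ ∘ Ψ` on `Ψ.source` and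
satisfies `(1_{Ψ.source}(ζ ∘ Ψ)) ∘ Ψ⁻¹ = ζ` on `Ψ.target`. [cite: LeeSmoothManifolds2013, Lemma 2.26] -/
theorem contDiff_indicator_comp_of_tsupport_subset [T2Space H] {Ψ : OpenPartialHomeomorph H H}
    (hΨ : ContDiffOn ℝ ∞ Ψ Ψ.source) {ζ : H → ℝ} (hζ : ContDiff ℝ ∞ ζ)
    (hζc : HasCompactSupport ζ) (hζt : tsupport ζ ⊆ Ψ.target) :
    ContDiff ℝ ∞ (Ψ.source.indicator (ζ ∘ Ψ)) ∧ HasCompactSupport (Ψ.source.indicator (ζ ∘ Ψ)) ∧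
      tsupport (Ψ.source.indicator (ζ ∘ Ψ)) ⊆ Ψ.symm '' tsupport ζ ∧
      Ψ.symm '' tsupport ζ ⊆ Ψ.source ∧
      (∀ y ∈ Ψ.source, Ψ.source.indicator (ζ ∘ Ψ) y = ζ (Ψ y)) ∧
      ∀ w ∈ Ψ.target, Ψ.source.indicator (ζ ∘ Ψ) (Ψ.symm w) = ζ w := by
  set ψ := Ψ.source.indicator (ζ ∘ Ψ) with hψ
  have hKc : IsCompact (Ψ.symm '' tsupport ζ) :=
    hζc.isCompact.image_of_continuousOn (Ψ.continuousOn_symm.mono hζt)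
  have hKS : Ψ.symm '' tsupport ζ ⊆ Ψ.source := by
    rintro _ ⟨w, hw, rfl⟩; exact Ψ.map_target (hζt hw)
  have hts : tsupport ψ ⊆ Ψ.symm '' tsupport ζ := by
    refine closure_minimal (fun y hy ↦ ?_) hKc.isClosed
    rw [mem_support] at hy
    by_cases hys : y ∈ Ψ.source
    · rw [hψ, indicator_of_mem hys, Function.comp_apply] at hy
      exact ⟨Ψ y, subset_tsupport _ (mem_support.2 hy), Ψ.left_inv hys⟩
    · exact absurd (indicator_of_notMem hys _) hy
  have hval : ∀ y ∈ Ψ.source, ψ y = ζ (Ψ y) := fun y hy ↦ by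
    rw [hψ, indicator_of_mem hy, Function.comp_apply]
  refine ⟨?_, hKc.of_isClosed_subset isClosed_closure hts, hts, hKS, hval, fun w hw ↦ ?_⟩
  · rw [contDiff_iff_contDiffAt]
    intro y
    by_cases hy : y ∈ tsupport ψ
    · have hys : y ∈ Ψ.source := hKS (hts hy)
      have hev : ψ =ᶠ[𝓝 y] ζ ∘ Ψ := by
        filter_upwards [Ψ.open_source.mem_nhds hys] with y' hy'
        rw [hval y' hy', Function.comp_apply]
      refine ContDiffAt.congr_of_eventuallyEq ?_ hev
      exact hζ.contDiffAt.comp y (hΨ.contDiffAt (Ψ.open_source.mem_nhds hys))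
    · have hev : ψ =ᶠ[𝓝 y] fun _ ↦ 0 := by
        filter_upwards [(isClosed_tsupport ψ).isOpen_compl.mem_nhds hy] with y' hy'
        exact image_eq_zero_of_notMem_tsupport hy'
      exact contDiffAt_const.congr_of_eventuallyEq hev
  · rw [hval _ (Ψ.map_target hw), Ψ.right_inv hw]

/-- **The determinant of `DΨ⁻¹` is `C^∞` on `Ψ.target`** (entries of the matrix of `DΨ⁻¹` in the
standard basis are smooth; Leibniz expansion). [folklore] -/
theorem contDiffOn_det_fderiv_symm {m : ℕ}
    {Ψ : OpenPartialHomeomorph (EuclideanSpace ℝ (Fin m)) (EuclideanSpace ℝ (Fin m))}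
    (hΨ' : ContDiffOn ℝ ∞ Ψ.symm Ψ.target) :
    ContDiffOn ℝ ∞ (fun w ↦ (fderiv ℝ Ψ.symm w).det) Ψ.target := by
  classical
  set b := (EuclideanSpace.basisFun (Fin m) ℝ).toBasis with hb
  have hD : ContDiffOn ℝ ∞ (fun w ↦ fderiv ℝ Ψ.symm w) Ψ.target :=
    hΨ'.fderiv_of_isOpen Ψ.open_target le_rfl
  have hent : ∀ i j, ContDiffOn ℝ ∞
      (fun w ↦ LinearMap.toMatrix b b (fderiv ℝ Ψ.symm w).toLinearMap i j) Ψ.target := by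
    intro i j
    have h1 : ∀ w, LinearMap.toMatrix b b (fderiv ℝ Ψ.symm w).toLinearMap i j =
        (fderiv ℝ Ψ.symm w (b j)) i := fun w ↦ by
      simp [hb, LinearMap.toMatrix_apply]
    simp_rw [h1]
    have h2 : ContDiffOn ℝ ∞ (fun w ↦ fderiv ℝ Ψ.symm w (b j)) Ψ.target :=
      hD.clm_apply contDiffOn_const
    exact (EuclideanSpace.proj i).contDiff.comp_contDiffOn h2
  have heq : ∀ w, (fderiv ℝ Ψ.symm w).det =
      (LinearMap.toMatrix b b (fderiv ℝ Ψ.symm w).toLinearMap).det := fun w ↦ by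
    rw [LinearMap.det_toMatrix]
  simp_rw [heq]
  exact ContDiffOn.matrix_det (A := fun w ↦ LinearMap.toMatrix b b (fderiv ℝ Ψ.symm w).toLinearMap)
    hent

/-- **`|det DΨ⁻¹|` is `C^∞` on convex parts of `Ψ.target`**: the determinant is continuous and
nonvanishing there, hence of constant sign (intermediate value theorem on the preconnected
convex set). [folklore] -/
theorem contDiffOn_abs_det_fderiv_symm_of_convex {m : ℕ}
    {Ψ : OpenPartialHomeomorph (EuclideanSpace ℝ (Fin m)) (EuclideanSpace ℝ (Fin m))}
    (hΨ : ContDiffOn ℝ ∞ Ψ Ψ.source) (hΨ' : ContDiffOn ℝ ∞ Ψ.symm Ψ.target)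
    {B : Set (EuclideanSpace ℝ (Fin m))} (hBc : Convex ℝ B) (hB : B ⊆ Ψ.target) :
    ContDiffOn ℝ ∞ (fun w ↦ |(fderiv ℝ Ψ.symm w).det|) B := by
  have hdet := (contDiffOn_det_fderiv_symm hΨ').mono hB
  have hne : ∀ w ∈ B, (fderiv ℝ Ψ.symm w).det ≠ 0 := fun w hw ↦
    det_fderiv_symm_ne_zero (hB hw)
      ((hΨ.differentiableOn (by simp) _ (Ψ.map_target (hB hw))).differentiableAt
        (Ψ.open_source.mem_nhds (Ψ.map_target (hB hw))))
      ((hΨ'.differentiableOn (by simp) _ (hB hw)).differentiableAt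
        (Ψ.open_target.mem_nhds (hB hw)))
  have hpc : IsPreconnected B := hBc.isPreconnected
  by_cases hBne : B.Nonempty
  · obtain ⟨w₀, hw₀⟩ := hBne
    rcases lt_or_gt_of_ne (hne w₀ hw₀) with hneg | hpos
    · -- everywhere negative
      have hall : ∀ w ∈ B, (fderiv ℝ Ψ.symm w).det < 0 := by
        intro w hw
        by_contra hge
        have hge' : 0 ≤ (fderiv ℝ Ψ.symm w).det := not_lt.1 hge
        obtain ⟨c, hc, hc0⟩ := hpc.intermediate_value hw₀ hw hdet.continuousOn
          ⟨hneg.le, hge'⟩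
        exact hne c hc hc0
      refine (hdet.neg).congr fun w hw ↦ ?_
      show |(fderiv ℝ Ψ.symm w).det| = -(fderiv ℝ Ψ.symm w).det
      exact abs_of_neg (hall w hw)
    · have hall : ∀ w ∈ B, 0 < (fderiv ℝ Ψ.symm w).det := by
        intro w hw
        by_contra hle
        have hle' : (fderiv ℝ Ψ.symm w).det ≤ 0 := not_lt.1 hle
        obtain ⟨c, hc, hc0⟩ := hpc.intermediate_value hw hw₀ hdet.continuousOn
          ⟨hle', hpos.le⟩
        exact hne c hc hc0
      refine hdet.congr fun w hw ↦ ?_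
      show |(fderiv ℝ Ψ.symm w).det| = (fderiv ℝ Ψ.symm w).det
      exact abs_of_pos (hall w hw)
  · rw [not_nonempty_iff_eq_empty] at hBne
    rw [hBne]; exact contDiffOn_empty

end Euclidean

/-! ### The manifold setting -/

variable {m : ℕ} {M : Type*} [TopologicalSpace M] [ChartedSpace (EuclideanSpace ℝ (Fin m)) M]
  [IsManifold (𝓡 m) ∞ M] [T2Space M] [LocallyCompactSpace M] [MeasurableSpace M] [BorelSpace M]

variable (h : ContMDiffRiemannianMetric (𝓡 m) ∞ (EuclideanSpace ℝ (Fin m))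
  (TangentSpace (𝓡 m) : M → Type _)) (x : M)

omit [T2Space M] [LocallyCompactSpace M] [MeasurableSpace M] [BorelSpace M] in
/-- **The composite density is `C^∞` on convex parts of `Ψ.target`.** [folklore] -/
theorem contDiffOn_compositeDensity_of_convex
    {Ψ : OpenPartialHomeomorph (EuclideanSpace ℝ (Fin m)) (EuclideanSpace ℝ (Fin m))}
    (hΨt : Ψ.source ⊆ (extChartAt (𝓡 m) x).target) (hΨ : ContDiffOn ℝ ∞ Ψ Ψ.source)
    (hΨ' : ContDiffOn ℝ ∞ Ψ.symm Ψ.target) {B : Set (EuclideanSpace ℝ (Fin m))}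
    (hBc : Convex ℝ B) (hB : B ⊆ Ψ.target) :
    ContDiffOn ℝ ∞ (fun w ↦ |(fderiv ℝ Ψ.symm w).det| *
      Real.sqrt (chartGramMatrix h x (Ψ.symm w)).det) B := by
  refine (contDiffOn_abs_det_fderiv_symm_of_convex hΨ hΨ' hBc hB).mul ?_
  exact ((contDiffOn_sqrt_det_chartGramMatrix h x).comp hΨ'
    (fun w hw ↦ hΨt (Ψ.map_target hw))).mono hB

/-! ### Pull-back of Euclidean test functions through a composite chart -/

section Pullback

variable {Ψ : OpenPartialHomeomorph (EuclideanSpace ℝ (Fin m)) (EuclideanSpace ℝ (Fin m))}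
  {ζ : EuclideanSpace ℝ (Fin m) → ℝ}

omit [LocallyCompactSpace M] [MeasurableSpace M] [BorelSpace M] in
/-- **Pull-back of a Euclidean test function through a composite chart.** For `ζ ∈ C_c^∞` with
`tsupport ζ ⊆ Ψ.target` and `Ψ.source ⊆ φ.target` (`φ = extChartAt (𝓡 m) x`), the function
`ζ_P = 1_{chart source} · ((1_{Ψ.source}(ζ ∘ Ψ)) ∘ φ)` is `C^∞` on `M` with compact support,
`ζ_P(φ⁻¹(Ψ⁻¹ w)) = ζ w` on `Ψ.target`, and `ζ_P` vanishes off the composite piece over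
`tsupport ζ`. [cite: LeeSmoothManifolds2013, Lemma 2.26] -/
theorem compositePullback_props (hΨt : Ψ.source ⊆ (extChartAt (𝓡 m) x).target)
    (hΨ : ContDiffOn ℝ ∞ Ψ Ψ.source) (hζ : ContDiff ℝ ∞ ζ) (hζc : HasCompactSupport ζ)
    (hζt : tsupport ζ ⊆ Ψ.target) :
    ContMDiff (𝓡 m) 𝓘(ℝ, ℝ) ∞ ((chartAt (EuclideanSpace ℝ (Fin m)) x).source.indicator
        (Ψ.source.indicator (ζ ∘ Ψ) ∘ extChartAt (𝓡 m) x)) ∧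
      HasCompactSupport ((chartAt (EuclideanSpace ℝ (Fin m)) x).source.indicator
        (Ψ.source.indicator (ζ ∘ Ψ) ∘ extChartAt (𝓡 m) x)) ∧
      (∀ w ∈ Ψ.target, (chartAt (EuclideanSpace ℝ (Fin m)) x).source.indicator
        (Ψ.source.indicator (ζ ∘ Ψ) ∘ extChartAt (𝓡 m) x)
          ((extChartAt (𝓡 m) x).symm (Ψ.symm w)) = ζ w) ∧
      (∀ y ∈ (extChartAt (𝓡 m) x).target, (chartAt (EuclideanSpace ℝ (Fin m)) x).source.indicator
        (Ψ.source.indicator (ζ ∘ Ψ) ∘ extChartAt (𝓡 m) x) ((extChartAt (𝓡 m) x).symm y) =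
          Ψ.source.indicator (ζ ∘ Ψ) y) ∧
      ∀ p, p ∉ (extChartAt (𝓡 m) x).source ∩ extChartAt (𝓡 m) x ⁻¹' (Ψ.symm '' tsupport ζ) →
        (chartAt (EuclideanSpace ℝ (Fin m)) x).source.indicator
          (Ψ.source.indicator (ζ ∘ Ψ) ∘ extChartAt (𝓡 m) x) p = 0 := by
  obtain ⟨hψs, hψc, hψts, hKS, hψval, hψsymm⟩ :=
    contDiff_indicator_comp_of_tsupport_subset hΨ hζ hζc hζt
  set ψ := Ψ.source.indicator (ζ ∘ Ψ) with hψ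
  have hψT : tsupport ψ ⊆ (extChartAt (𝓡 m) x).target := hψts.trans (hKS.trans hΨt)
  refine ⟨contMDiff_indicator_comp_extChartAt (I := 𝓡 m) x hψs hψc hψT,
    hasCompactSupport_indicator_comp_extChartAt (I := 𝓡 m) x hψc hψT, fun w hw ↦ ?_,
    fun y hy ↦ indicator_comp_extChartAt_symm_apply (I := 𝓡 m) x ψ hy, fun p hp ↦ ?_⟩
  · rw [indicator_comp_extChartAt_symm_apply (I := 𝓡 m) x ψ (hΨt (Ψ.map_target hw))]
    exact hψsymm w hw
  · -- off the piece over `tsupport ζ` the pull-back vanishes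
    by_cases hps : p ∈ (chartAt (EuclideanSpace ℝ (Fin m)) x).source
    · rw [indicator_of_mem hps, Function.comp_apply]
      have hps' : p ∈ (extChartAt (𝓡 m) x).source := by rwa [extChartAt_source]
      have hnot : extChartAt (𝓡 m) x p ∉ Ψ.symm '' tsupport ζ := fun h' ↦ hp ⟨hps', h'⟩
      have hnt : extChartAt (𝓡 m) x p ∉ tsupport ψ := fun h' ↦ hnot (hψts h')
      exact image_eq_zero_of_notMem_tsupport hnt
    · exact indicator_of_notMem hps _

omit [LocallyCompactSpace M] [MeasurableSpace M] [BorelSpace M] in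
/-- **The composite representative of the pull-back is `ζ` near every point of `Ψ.target`.**
[folklore] -/
theorem compositePullback_rep_eventuallyEq (hΨt : Ψ.source ⊆ (extChartAt (𝓡 m) x).target)
    (hΨ : ContDiffOn ℝ ∞ Ψ Ψ.source) (hζ : ContDiff ℝ ∞ ζ) (hζc : HasCompactSupport ζ)
    (hζt : tsupport ζ ⊆ Ψ.target) {w : EuclideanSpace ℝ (Fin m)} (hw : w ∈ Ψ.target) :
    ((chartAt (EuclideanSpace ℝ (Fin m)) x).source.indicator
        (Ψ.source.indicator (ζ ∘ Ψ) ∘ extChartAt (𝓡 m) x) ∘ (extChartAt (𝓡 m) x).symm ∘ Ψ.symm)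
      =ᶠ[𝓝 w] ζ := by
  obtain ⟨-, -, hval, -, -⟩ := compositePullback_props x hΨt hΨ hζ hζc hζt
  filter_upwards [Ψ.open_target.mem_nhds hw] with w' hw'
  simp only [Function.comp_apply]
  exact hval w' hw'

omit [LocallyCompactSpace M] [MeasurableSpace M] [BorelSpace M] in
/-- The gradient of the composite representative of the pull-back is `∇ζ` on `Ψ.target`.
[folklore] -/
theorem gradient_compositePullback_rep (hΨt : Ψ.source ⊆ (extChartAt (𝓡 m) x).target)
    (hΨ : ContDiffOn ℝ ∞ Ψ Ψ.source) (hζ : ContDiff ℝ ∞ ζ) (hζc : HasCompactSupport ζ)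
    (hζt : tsupport ζ ⊆ Ψ.target) {w : EuclideanSpace ℝ (Fin m)} (hw : w ∈ Ψ.target) :
    gradient ((chartAt (EuclideanSpace ℝ (Fin m)) x).source.indicator
        (Ψ.source.indicator (ζ ∘ Ψ) ∘ extChartAt (𝓡 m) x) ∘ (extChartAt (𝓡 m) x).symm ∘ Ψ.symm) w =
      gradient ζ w := by
  have hev := compositePullback_rep_eventuallyEq x hΨt hΨ hζ hζc hζt hw
  unfold gradient
  rw [hev.fderiv_eq]

end Pullback

/-! ### Integral identities -/

section Integrals

variable {Ψ : OpenPartialHomeomorph (EuclideanSpace ℝ (Fin m)) (EuclideanSpace ℝ (Fin m))}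
  {ζ : EuclideanSpace ℝ (Fin m) → ℝ}

omit [T2Space M] [LocallyCompactSpace M] in
/-- An integral over `D` of a function vanishing off the piece over `B`, where `D` meets that
piece in the piece over `Q`, is the integral over the piece over `Q`. [folklore] -/
theorem setIntegral_eq_setIntegral_piece [T3Space M] {D : Set M} (hDm : MeasurableSet D)
    {B Q : Set (EuclideanSpace ℝ (Fin m))}
    (hDQ : D ∩ ((extChartAt (𝓡 m) x).source ∩ extChartAt (𝓡 m) x ⁻¹' (Ψ.symm '' B)) =
      (extChartAt (𝓡 m) x).source ∩ extChartAt (𝓡 m) x ⁻¹' (Ψ.symm '' Q))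
    {G : M → ℝ} (hG : ∀ p, p ∉ (extChartAt (𝓡 m) x).source ∩ extChartAt (𝓡 m) x ⁻¹' (Ψ.symm '' B) →
      G p = 0) :
    ∫ p in D, G p ∂riemannianMeasure h =
      ∫ p in (extChartAt (𝓡 m) x).source ∩ extChartAt (𝓡 m) x ⁻¹' (Ψ.symm '' Q), G p
        ∂riemannianMeasure h := by
  rw [← hDQ]
  exact setIntegral_eq_of_subset_of_forall_sdiff_eq_zero hDm inter_subset_left
    fun p hp ↦ hG p fun h' ↦ hp.2 ⟨hp.1, h'⟩

omit [LocallyCompactSpace M] in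
/-- **Zeroth-order integrals in a composite chart.** With `ζ_P` the pull-back of a Euclidean test
function `ζ` with `tsupport ζ ⊆ B ⊆ Ψ.target` (`B` measurable), a measurable set `D ⊆ M` meeting
the piece over `B` in the piece over the measurable `Q ⊆ B`, and `F : M → ℝ` measurable:
`∫_D F ζ_P dμ_h = ∫_Q ρ(w) F(Φ⁻¹ w) ζ(w) dw`, `ρ = |det DΨ⁻¹| √det(h_ij) ∘ Ψ⁻¹`.
[cite: LeeSmoothManifolds2013, Prop. 16.6] -/
theorem setIntegral_mul_compositePullback [T3Space M]
    (hΨt : Ψ.source ⊆ (extChartAt (𝓡 m) x).target)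
    (hΨ : ContDiffOn ℝ ∞ Ψ Ψ.source) (hΨ' : ContDiffOn ℝ ∞ Ψ.symm Ψ.target)
    (hζ : ContDiff ℝ ∞ ζ) (hζc : HasCompactSupport ζ)
    {B Q : Set (EuclideanSpace ℝ (Fin m))} (hζB : tsupport ζ ⊆ B) (hB : B ⊆ Ψ.target)
    (hQm : MeasurableSet Q) (hQB : Q ⊆ B) {D : Set M} (hDm : MeasurableSet D)
    (hDQ : D ∩ ((extChartAt (𝓡 m) x).source ∩ extChartAt (𝓡 m) x ⁻¹' (Ψ.symm '' B)) =
      (extChartAt (𝓡 m) x).source ∩ extChartAt (𝓡 m) x ⁻¹' (Ψ.symm '' Q))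
    {F : M → ℝ} (hF : Measurable F) :
    ∫ p in D, F p * (chartAt (EuclideanSpace ℝ (Fin m)) x).source.indicator
        (Ψ.source.indicator (ζ ∘ Ψ) ∘ extChartAt (𝓡 m) x) p ∂riemannianMeasure h =
      ∫ w in Q, (|(fderiv ℝ Ψ.symm w).det| * Real.sqrt (chartGramMatrix h x (Ψ.symm w)).det) *
        (F ((extChartAt (𝓡 m) x).symm (Ψ.symm w)) * ζ w) := by
  obtain ⟨hζPs, -, hval, -, hzero⟩ := compositePullback_props x hΨt hΨ hζ hζc (hζB.trans hB)
  set ζP := (chartAt (EuclideanSpace ℝ (Fin m)) x).source.indicator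
    (Ψ.source.indicator (ζ ∘ Ψ) ∘ extChartAt (𝓡 m) x) with hζP
  have hvan : ∀ p, p ∉ (extChartAt (𝓡 m) x).source ∩ extChartAt (𝓡 m) x ⁻¹' (Ψ.symm '' B) →
      F p * ζP p = 0 := by
    intro p hp
    rw [hzero p fun h' ↦ hp ⟨h'.1, image_mono hζB h'.2⟩, mul_zero]
  rw [setIntegral_eq_setIntegral_piece h x hDm hDQ hvan]
  have hmeas : Measurable fun p ↦ F p * ζP p := hF.mul hζPs.continuous.measurable
  rw [setIntegral_compositeChart h x hΨt (hΨ'.differentiableOn (by simp)) hQm (hQB.trans hB) hmeas]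
  refine setIntegral_congr_fun hQm fun w hw ↦ ?_
  rw [hval w (hB (hQB hw))]

omit [LocallyCompactSpace M] in
/-- **First-order (Dirichlet) integrals in a composite chart.** With the notation of
`setIntegral_mul_compositePullback`, for `a ∈ C¹(M)` and `f : M → ℝ` continuous:
`∫_D f h⁻¹(da, dζ_P) dμ_h = ∫_Q ρ(w) f(Φ⁻¹ w) ⟪M(w) ∇ã(w), ∇ζ(w)⟫ dw`, where `ã = a ∘ Φ⁻¹` and
`M` is the coefficient field of `innerDual_mvfderiv_compositeChart`.
[cite: LeeSmoothManifolds2013, Prop. 16.6] -/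
theorem setIntegral_mul_innerDual_compositePullback [T3Space M]
    (hΨt : Ψ.source ⊆ (extChartAt (𝓡 m) x).target)
    (hΨ : ContDiffOn ℝ ∞ Ψ Ψ.source) (hΨ' : ContDiffOn ℝ ∞ Ψ.symm Ψ.target)
    (hζ : ContDiff ℝ ∞ ζ) (hζc : HasCompactSupport ζ)
    {B Q : Set (EuclideanSpace ℝ (Fin m))} (hζB : tsupport ζ ⊆ B) (hB : B ⊆ Ψ.target)
    (hQm : MeasurableSet Q) (hQB : Q ⊆ B) {D : Set M} (hDm : MeasurableSet D)
    (hDQ : D ∩ ((extChartAt (𝓡 m) x).source ∩ extChartAt (𝓡 m) x ⁻¹' (Ψ.symm '' B)) =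
      (extChartAt (𝓡 m) x).source ∩ extChartAt (𝓡 m) x ⁻¹' (Ψ.symm '' Q))
    {f : M → ℝ} (hf : Continuous f) {a : M → ℝ} (ha : ContMDiff (𝓡 m) 𝓘(ℝ, ℝ) 1 a) :
    ∫ p in D, f p * (ofRiemannian h).innerDual p (mvfderiv (𝓡 m) a p).toLinearMap
        (mvfderiv (𝓡 m) ((chartAt (EuclideanSpace ℝ (Fin m)) x).source.indicator
          (Ψ.source.indicator (ζ ∘ Ψ) ∘ extChartAt (𝓡 m) x)) p).toLinearMap ∂riemannianMeasure h =
      ∫ w in Q, (|(fderiv ℝ Ψ.symm w).det| * Real.sqrt (chartGramMatrix h x (Ψ.symm w)).det) *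
        (f ((extChartAt (𝓡 m) x).symm (Ψ.symm w)) *
          ⟪(∑ i, ∑ j, (chartGramMatrix h x (Ψ.symm w))⁻¹ i j •
            (innerSL ℝ (fderiv ℝ Ψ (Ψ.symm w) (EuclideanSpace.single i 1))).smulRight
              (fderiv ℝ Ψ (Ψ.symm w) (EuclideanSpace.single j 1)))
            (gradient (a ∘ (extChartAt (𝓡 m) x).symm ∘ Ψ.symm) w), gradient ζ w⟫) := by
  obtain ⟨hζPs, -, hval, -, hzero⟩ := compositePullback_props x hΨt hΨ hζ hζc (hζB.trans hB)
  set ζP := (chartAt (EuclideanSpace ℝ (Fin m)) x).source.indicator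
    (Ψ.source.indicator (ζ ∘ Ψ) ∘ extChartAt (𝓡 m) x) with hζP
  have hζP1 : ContMDiff (𝓡 m) 𝓘(ℝ, ℝ) 1 ζP := hζPs.of_le (by norm_cast)
  -- the support of `dζ_P` lies in the (open) piece over `B`? We use the closed description:
  -- `ζ_P` vanishes identically off the piece over `tsupport ζ`, which is closed
  have hKc : IsClosed ((extChartAt (𝓡 m) x).source ∩ extChartAt (𝓡 m) x ⁻¹' (Ψ.symm '' tsupport ζ)) := by
    have hc : IsCompact (Ψ.symm '' tsupport ζ) :=
      hζc.isCompact.image_of_continuousOn (Ψ.continuousOn_symm.mono (hζB.trans hB))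
    have hcs : Ψ.symm '' tsupport ζ ⊆ Ψ.source := by
      rintro _ ⟨w, hw, rfl⟩; exact Ψ.map_target (hB (hζB hw))
    have himg : (extChartAt (𝓡 m) x).source ∩ extChartAt (𝓡 m) x ⁻¹' (Ψ.symm '' tsupport ζ) =
        (extChartAt (𝓡 m) x).symm '' (Ψ.symm '' tsupport ζ) := by
      ext p
      constructor
      · rintro ⟨hp, hpi⟩
        exact ⟨extChartAt (𝓡 m) x p, hpi, (extChartAt (𝓡 m) x).left_inv hp⟩
      · rintro ⟨y, hy, rfl⟩
        have hyT : y ∈ (extChartAt (𝓡 m) x).target := hΨt (hcs hy)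
        exact ⟨(extChartAt (𝓡 m) x).map_target hyT, by
          rw [mem_preimage, (extChartAt (𝓡 m) x).right_inv hyT]; exact hy⟩
    rw [himg]
    exact (hc.image_of_continuousOn ((continuousOn_extChartAt_symm x).mono
      (hcs.trans hΨt))).isClosed
  have hvan : ∀ p, p ∉ (extChartAt (𝓡 m) x).source ∩ extChartAt (𝓡 m) x ⁻¹' (Ψ.symm '' B) →
      f p * (ofRiemannian h).innerDual p (mvfderiv (𝓡 m) a p).toLinearMap
        (mvfderiv (𝓡 m) ζP p).toLinearMap = 0 := by
    intro p hp
    have hp' : p ∉ (extChartAt (𝓡 m) x).source ∩ extChartAt (𝓡 m) x ⁻¹' (Ψ.symm '' tsupport ζ) :=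
      fun h' ↦ hp ⟨h'.1, image_mono hζB h'.2⟩
    -- `ζ_P` vanishes on a neighbourhood of `p`
    have hev : ζP =ᶠ[𝓝 p] fun _ ↦ 0 := by
      filter_upwards [hKc.isOpen_compl.mem_nhds hp'] with q hq
      exact hzero q hq
    have h0 : mvfderiv (𝓡 m) ζP p = 0 := mvfderiv_eq_zero_of_eventuallyEq_zero hev
    rw [h0]
    simp [PseudoRiemannianMetric.innerDual]
  rw [setIntegral_eq_setIntegral_piece h x hDm hDQ hvan]
  have hmeas : Measurable fun p ↦ f p * (ofRiemannian h).innerDual p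
      (mvfderiv (𝓡 m) a p).toLinearMap (mvfderiv (𝓡 m) ζP p).toLinearMap :=
    (hf.mul (continuous_innerDual_mvfderiv (ofRiemannian h) ha hζP1)).measurable
  rw [setIntegral_compositeChart h x hΨt (hΨ'.differentiableOn (by simp)) hQm (hQB.trans hB) hmeas]
  refine setIntegral_congr_fun hQm fun w hw ↦ ?_
  have hwt : w ∈ Ψ.target := hB (hQB hw)
  have hdΨ : DifferentiableAt ℝ Ψ (Ψ.symm w) :=
    (hΨ.differentiableOn (by simp) _ (Ψ.map_target hwt)).differentiableAt
      (Ψ.open_source.mem_nhds (Ψ.map_target hwt))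
  have hdΨ' : DifferentiableAt ℝ Ψ.symm w :=
    (hΨ'.differentiableOn (by simp) _ hwt).differentiableAt (Ψ.open_target.mem_nhds hwt)
  simp only
  rw [innerDual_mvfderiv_compositeChart h x hΨt hwt hdΨ hdΨ'
    ((ha _).mdifferentiableAt one_ne_zero) ((hζP1 _).mdifferentiableAt one_ne_zero),
    gradient_compositePullback_rep x hΨt hΨ hζ hζc (hζB.trans hB) hwt]

end Integrals

end Literature.Geometry.Riemannian

end
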